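import Mathlib
import Summits.NavierStokesRegularity.OSWSelfSimilar.SheetHalfLineIdentity
import Summits.NavierStokesRegularity.OSWSelfSimilar.SheetHalfLineThirdRowCheck
import HarnessLib

/-!
# Non-vacuity witness for the half-line identity (★): the kernel exact row `c_l = 1/3` meets EVERY hypothesis of
# `SheetHalfLine.halfLine_identity_gCLM` with the genuine Hilbert transform

HONEST FRAMING (cell ns-blowup GROUP B «PROFILE SEARCH», zone Z3 = the 1-D viscous gCLM/OSW sheet; human rulings
D-0035/D-0074): **1-D MODEL; calculus kernel-checked; not Euler, not Navier–Stokes; «violates: none — MODEL».**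

PURPOSE (refuter-style non-vacuity probe for `SheetHalfLineIdentity`, pattern of `HouLuoViscousThetaFloorWitness`): the
explicit-hypothesis theorem `SheetHalfLine.halfLine_identity_gCLM` lists fourteen hypotheses (derivatives, the sheet equation on
`(0,∞)`, five integrabilities on `(0,∞)`, three limits at `+∞`). Here they are ALL DISCHARGED for a nontrivial exact sheet point —
the dilated double-pole row `c_l = 1/3` of `SheetRowThirdExactFamily` / `SheetRowThirdHilbert`
(`Ω(η) = −A f(η/ℓ)`, `f(x) = x/(1+x²)²`, `A = 8/(3a)`, `𝒰(η) = −Aℓ 𝒰_f(η/ℓ)`, `ℓ²(1−2a) = 9εa`, `a ≠ 0`, `ℓ > 0`) with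
`H = hilbertTransform Ω` the GENUINE Hilbert transform of `Literature/Analysis/Fourier/HilbertTransformLine.lean` — so the
hypothesis set of (★) is jointly satisfiable by a sheet point that is not `0` (`thirdRow_ne_zero`), and (★) holds there
(`halfLine_identity_thirdRow`; its closed-form content is `SheetHalfLine.halfLine_thirdRow_check`).
Ingredients: the bounds (`|x| ≤ (1+x²)/2`, cf. the tree's `BoseGas.abs_le_half_one_add_sq`) `|f| ≤ 1/(2(1+x²))`, `|x f′| ≤ 3|f|`, `|f′| ≤ 3/(1+x²)`, `|𝒰_f| ≤ 1/4`, `|f″| ≤ 12|f|` and the limit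
`(1 + (ξ/ℓ)²)⁻¹ → 0`. No definitions. bears_on: LADDER-NS N5 / Z3 clause (i′) audit → N1 linear core. WHAT THIS IS NOT: not NS.
-/

noncomputable section
open Set Filter Topology MeasureTheory

namespace Summit.NavierStokesRegularity.OSWSelfSimilar
namespace SheetHalfLine
open SheetRowThirdExactFamily Literature.Analysis.Fourier
open HouLuoOriginLaws (F1)

/-! ### Pointwise bounds for the double-pole profile and its derivatives -/

/-- `|f(x)| ≤ 1/(2(1+x²))`. [folklore] -/
theorem abs_profile_le (x : ℝ) : |profile x| ≤ 1 / (2 * (1 + x ^ 2)) := by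
  unfold profile
  have hq : 0 < 1 + x ^ 2 := by positivity
  have hx : |x| ≤ (1 + x ^ 2) / 2 := by
    rw [abs_le]; constructor <;> nlinarith [sq_nonneg (x + 1), sq_nonneg (x - 1)]
  rw [abs_div, abs_of_pos (by positivity : (0:ℝ) < (1 + x ^ 2) ^ 2), div_le_div_iff₀ (by positivity) (by positivity)]
  nlinarith [hx, abs_nonneg x, sq_nonneg x]

/-- `|x f′(x)| ≤ 3|f(x)|`. [folklore] -/
theorem abs_mul_dProfile_le (x : ℝ) : |x * dProfile x| ≤ 3 * |profile x| := by
  unfold dProfile profile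
  have hq : 0 < 1 + x ^ 2 := by positivity
  rw [abs_mul, abs_div, abs_div, abs_of_pos (by positivity : (0:ℝ) < (1 + x ^ 2) ^ 3),
    abs_of_pos (by positivity : (0:ℝ) < (1 + x ^ 2) ^ 2)]
  have h1 : |1 - 3 * x ^ 2| ≤ 3 * (1 + x ^ 2) := by
    rw [abs_le]; constructor <;> nlinarith [sq_nonneg x]
  have h2 : |x| * (|1 - 3 * x ^ 2| / (1 + x ^ 2) ^ 3) ≤ |x| * (3 * (1 + x ^ 2) / (1 + x ^ 2) ^ 3) :=
    mul_le_mul_of_nonneg_left (div_le_div_of_nonneg_right h1 (by positivity)) (abs_nonneg x)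
  have h3 : |x| * (3 * (1 + x ^ 2) / (1 + x ^ 2) ^ 3) = 3 * (|x| / (1 + x ^ 2) ^ 2) := by
    field_simp
  linarith [h2, h3]

/-- `|f′(x)| ≤ 3/(1+x²)`. [folklore] -/
theorem abs_dProfile_le (x : ℝ) : |dProfile x| ≤ 3 * (1 + x ^ 2)⁻¹ := by
  unfold dProfile
  have hq : 0 < 1 + x ^ 2 := by positivity
  rw [abs_div, abs_of_pos (by positivity : (0:ℝ) < (1 + x ^ 2) ^ 3), div_le_iff₀ (by positivity)]
  have h1 : |1 - 3 * x ^ 2| ≤ 3 * (1 + x ^ 2) := by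
    rw [abs_le]; constructor <;> nlinarith [sq_nonneg x]
  have h2 : 3 * (1 + x ^ 2)⁻¹ * (1 + x ^ 2) ^ 3 = 3 * (1 + x ^ 2) ^ 2 := by field_simp
  rw [h2]
  nlinarith [sq_nonneg x, sq_nonneg (x ^ 2)]

/-- `|𝒰_f(x)| ≤ 1/4`. [folklore] -/
theorem abs_primProfile_le (x : ℝ) : |primProfile x| ≤ 1 / 4 := by
  unfold primProfile
  have hq : 0 < 1 + x ^ 2 := by positivity
  have hx : |x| ≤ (1 + x ^ 2) / 2 := by
    rw [abs_le]; constructor <;> nlinarith [sq_nonneg (x + 1), sq_nonneg (x - 1)]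
  rw [abs_div, abs_neg, abs_of_pos (by positivity : (0:ℝ) < 2 * (1 + x ^ 2)), div_le_div_iff₀ (by positivity) (by norm_num)]
  nlinarith [hx]

/-- `|f″(x)| ≤ 12|f(x)|`. [folklore] -/
theorem abs_ddProfile_le (x : ℝ) : |ddProfile x| ≤ 12 * |profile x| := by
  unfold ddProfile profile
  have hq : 0 < 1 + x ^ 2 := by positivity
  rw [abs_div, abs_div, abs_of_pos (by positivity : (0:ℝ) < (1 + x ^ 2) ^ 4),
    abs_of_pos (by positivity : (0:ℝ) < (1 + x ^ 2) ^ 2), abs_mul, abs_mul]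
  have h1 : |x ^ 2 - 1| ≤ 1 + x ^ 2 := by
    rw [abs_le]; constructor <;> nlinarith [sq_nonneg x]
  have h12 : |(12:ℝ)| = 12 := abs_of_pos (by norm_num)
  rw [h12, div_le_iff₀ (by positivity)]
  have h3 : 12 * (|x| / (1 + x ^ 2) ^ 2) * (1 + x ^ 2) ^ 4 = 12 * |x| * (1 + x ^ 2) ^ 2 := by field_simp
  rw [h3]
  have h4 : 12 * |x| * |x ^ 2 - 1| ≤ 12 * |x| * (1 + x ^ 2) := mul_le_mul_of_nonneg_left h1 (by positivity)
  have h5 : 12 * |x| * (1 + x ^ 2) ≤ 12 * |x| * (1 + x ^ 2) ^ 2 :=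
    mul_le_mul_of_nonneg_left (by nlinarith [sq_nonneg x]) (by positivity)
  linarith [h4, h5]

/-! ### Integrability of the profile pieces on `ℝ` -/

/-- `x f′(x)` is integrable. [folklore] -/
theorem integrable_mul_dProfile : Integrable fun x => x * dProfile x := by
  have hc : Continuous dProfile := continuous_iff_continuousAt.mpr fun x => (hasDerivAt_dProfile x).continuousAt
  refine Integrable.mono' ((integrable_profile.norm).const_mul 3) ((continuous_id.mul hc).aestronglyMeasurable)
    (Eventually.of_forall fun x => ?_)
  rw [Real.norm_eq_abs, Real.norm_eq_abs]
  exact abs_mul_dProfile_le x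

/-- `f′` is integrable. [folklore] -/
theorem integrable_dProfile : Integrable dProfile := by
  have hc : Continuous dProfile := continuous_iff_continuousAt.mpr fun x => (hasDerivAt_dProfile x).continuousAt
  refine Integrable.mono' (integrable_inv_one_add_sq.const_mul 3) hc.aestronglyMeasurable (Eventually.of_forall fun x => ?_)
  rw [Real.norm_eq_abs]
  exact abs_dProfile_le x

/-- `𝒰_f · f′` is integrable. [folklore] -/
theorem integrable_primProfile_mul_dProfile : Integrable fun x => primProfile x * dProfile x := by
  have hc : Continuous dProfile := continuous_iff_continuousAt.mpr fun x => (hasDerivAt_dProfile x).continuousAt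
  have hp : Continuous primProfile := continuous_iff_continuousAt.mpr fun x => (hasDerivAt_primProfile x).continuousAt
  refine Integrable.mono' ((integrable_dProfile.norm).const_mul (1 / 4)) ((hp.mul hc).aestronglyMeasurable)
    (Eventually.of_forall fun x => ?_)
  rw [norm_mul, Real.norm_eq_abs, Real.norm_eq_abs]
  exact mul_le_mul_of_nonneg_right (abs_primProfile_le x) (abs_nonneg _)

/-- `f″` is integrable. [folklore] -/
theorem integrable_ddProfile : Integrable ddProfile := by
  have hc : Continuous ddProfile := by
    unfold ddProfile
    exact ((continuous_const.mul continuous_id).mul ((continuous_id.pow 2).sub continuous_const)).div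
      ((continuous_const.add (continuous_id.pow 2)).pow 4) (fun x => by positivity)
  refine Integrable.mono' ((integrable_profile.norm).const_mul 12) hc.aestronglyMeasurable
    (Eventually.of_forall fun x => ?_)
  rw [Real.norm_eq_abs, Real.norm_eq_abs]
  exact abs_ddProfile_le x

/-! ### The witness -/

/-- `(1 + (ξ/ℓ)²)⁻¹ → 0` as `ξ → +∞` (`ℓ > 0`). [folklore] -/
theorem tendsto_inv_one_add_sq_div {ℓ : ℝ} (hℓ : 0 < ℓ) :
    Tendsto (fun ξ : ℝ => (1 + (ξ / ℓ) ^ 2)⁻¹) atTop (𝓝 0) := by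
  have h1 : Tendsto (fun ξ : ℝ => 1 + (ξ / ℓ) ^ 2) atTop atTop :=
    tendsto_const_nhds.add_atTop ((tendsto_pow_atTop two_ne_zero).comp (tendsto_id.atTop_div_const hℓ))
  exact h1.inv_tendsto_atTop

/-- The exact row is NOT the zero function (`Ω(ℓ) = −A/4 ≠ 0`). [folklore] -/
theorem thirdRow_ne_zero {a ℓ : ℝ} (ha : a ≠ 0) (hℓ : 0 < ℓ) :
    (fun η : ℝ => -(8 / (3 * a)) * profile (η / ℓ)) ℓ ≠ 0 := by
  have h1 : profile (ℓ / ℓ) = 1 / 4 := by rw [div_self hℓ.ne']; norm_num [profile]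
  simp only [h1]
  have h3a : (3 : ℝ) * a ≠ 0 := mul_ne_zero (by norm_num) ha
  exact mul_ne_zero (neg_ne_zero.mpr (div_ne_zero (by norm_num) h3a)) (by norm_num)

/-- **NON-VACUITY WITNESS: (★) instantiated on the exact row `c_l = 1/3` with the genuine Hilbert transform.** For `a ≠ 0`,
`ℓ > 0`, `ℓ²(1−2a) = 9εa`, with `Ω(η) = −A f(η/ℓ)`, `Ω′(η) = −(A/ℓ) f′(η/ℓ)`, `Ω″(η) = −(A/ℓ²) f″(η/ℓ)`, `𝒰(η) = −Aℓ 𝒰_f(η/ℓ)`,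
`A = 8/(3a)` and `H = hilbertTransform Ω`, ALL fourteen hypotheses of `SheetHalfLine.halfLine_identity_gCLM` at
`(c_ω, c_l) = (1, 1/3)` are discharged (derivatives: `SheetRowThirdHilbert`; sheet equation: `rowResidual_third_eq_zero`;
integrabilities and limits: the bounds above), whence
`(1 − 1/3)∫₀^∞ Ω − (1 + a)∫₀^∞ (HΩ)Ω + ε Ω′(0) = 0`. [new here — MODEL] -/
theorem halfLine_identity_thirdRow {a ε ℓ : ℝ} (ha : a ≠ 0) (hℓ : 0 < ℓ) (hwidth : ℓ ^ 2 * (1 - 2 * a) = 9 * ε * a) :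
    (1 - 1 / 3) * (∫ ξ in Ioi (0:ℝ), -(8 / (3 * a)) * profile (ξ / ℓ))
      - (1 + a) * (∫ ξ in Ioi (0:ℝ), hilbertTransform (fun η => -(8 / (3 * a)) * profile (η / ℓ)) ξ
          * (-(8 / (3 * a)) * profile (ξ / ℓ)))
      + ε * (-(8 / (3 * a) / ℓ) * dProfile (0 / ℓ)) = 0 := by
  generalize hA : (8 / (3 * a) : ℝ) = A
  have hℓ0 : ℓ ≠ 0 := hℓ.ne'
  set Om : ℝ → ℝ := fun η => -A * profile (η / ℓ) with hOmdef
  set dOm : ℝ → ℝ := fun η => -(A / ℓ) * dProfile (η / ℓ) with hdOmdef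
  set ddOm : ℝ → ℝ := fun η => -(A / ℓ ^ 2) * ddProfile (η / ℓ) with hddOmdef
  set U : ℝ → ℝ := fun η => -A * ℓ * primProfile (η / ℓ) with hUdef
  -- derivatives and the sheet equation
  have hU : ∀ ξ, HasDerivAt U (hilbertTransform Om ξ) ξ := fun ξ => hasDerivAt_dilatedPrim A hℓ ξ
  have hOm : ∀ ξ, HasDerivAt Om (dOm ξ) ξ := fun ξ => hasDerivAt_dilatedProfile A hℓ0 ξ
  have hdOm : ∀ ξ, HasDerivAt dOm (ddOm ξ) ξ := fun ξ => hasDerivAt_deriv_dilatedProfile A hℓ0 ξ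
  have hOm0 : Om 0 = 0 := by simp [hOmdef, profile]
  have hF : ∀ ξ ∈ Ioi (0:ℝ), F1 1 (1 / 3) a 1 ε (hilbertTransform Om) U Om dOm ddOm (fun _ => 0) ξ = 0 := by
    intro ξ _
    unfold HouLuoOriginLaws.F1
    rw [hilbertTransform_dilatedProfile A hℓ ξ]
    have key := rowResidual_third_eq_zero ha hℓ0 hwidth (ξ / ℓ)
    unfold rowResidual at key
    have hx : ℓ * (ξ / ℓ) = ξ := by field_simp
    rw [hx, hA] at key
    simp only [hOmdef, hdOmdef, hddOmdef, hUdef, one_mul, sub_zero]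
    linear_combination key
  -- integrabilities on (0,∞)
  have iOm : IntegrableOn Om (Ioi 0) := ((integrable_scaledProfile (-A)).comp_div hℓ0).integrableOn
  have iHOm : IntegrableOn (fun ξ => hilbertTransform Om ξ * Om ξ) (Ioi 0) := by
    have h := ((integrable_hilbProfile_mul_profile.comp_div hℓ0).const_mul (A ^ 2)).integrableOn (s := Ioi 0)
    refine h.congr_fun (fun ξ _ => ?_) measurableSet_Ioi
    simp only [hOmdef]
    rw [hilbertTransform_dilatedProfile A hℓ ξ]
    ring
  have iξd : IntegrableOn (fun ξ => ξ * dOm ξ) (Ioi 0) := by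
    have h := ((integrable_mul_dProfile.comp_div hℓ0).const_mul (-A)).integrableOn (s := Ioi 0)
    refine h.congr_fun (fun ξ _ => ?_) measurableSet_Ioi
    simp only [hdOmdef]
    field_simp
  have iUd : IntegrableOn (fun ξ => U ξ * dOm ξ) (Ioi 0) := by
    have h := ((integrable_primProfile_mul_dProfile.comp_div hℓ0).const_mul (A ^ 2)).integrableOn (s := Ioi 0)
    refine h.congr_fun (fun ξ _ => ?_) measurableSet_Ioi
    simp only [hUdef, hdOmdef]
    field_simp
  have idd : IntegrableOn ddOm (Ioi 0) :=
    (((integrable_ddProfile.comp_div hℓ0).const_mul (-(A / ℓ ^ 2))).integrableOn (s := Ioi 0))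
  -- limits at +∞
  have hlim := tendsto_inv_one_add_sq_div hℓ
  have hξOm : Tendsto (fun ξ => ξ * Om ξ) atTop (𝓝 0) := by
    refine squeeze_zero_norm (a := fun ξ => |A| * ℓ * (1 + (ξ / ℓ) ^ 2)⁻¹) (fun ξ => ?_)
      (by simpa using hlim.const_mul (|A| * ℓ))
    simp only [hOmdef]
    unfold profile
    have hq : 0 < 1 + (ξ / ℓ) ^ 2 := by positivity
    rw [Real.norm_eq_abs, abs_mul, abs_mul, abs_neg, abs_div, abs_of_pos (by positivity : (0:ℝ) < (1 + (ξ / ℓ) ^ 2) ^ 2)]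
    have h1 : |ξ| * |ξ / ℓ| = ℓ * (ξ / ℓ) ^ 2 := by
      rw [← abs_mul, show ξ * (ξ / ℓ) = ℓ * (ξ / ℓ) ^ 2 by field_simp, abs_of_nonneg (by positivity)]
    have h2 : (ξ / ℓ) ^ 2 ≤ 1 + (ξ / ℓ) ^ 2 := by linarith
    calc |ξ| * (|A| * (|ξ / ℓ| / (1 + (ξ / ℓ) ^ 2) ^ 2))
        = |A| * (|ξ| * |ξ / ℓ|) / (1 + (ξ / ℓ) ^ 2) ^ 2 := by ring
      _ = |A| * ℓ * ((ξ / ℓ) ^ 2 / (1 + (ξ / ℓ) ^ 2) ^ 2) := by rw [h1]; ring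
      _ ≤ |A| * ℓ * ((1 + (ξ / ℓ) ^ 2) / (1 + (ξ / ℓ) ^ 2) ^ 2) := by
          apply mul_le_mul_of_nonneg_left (div_le_div_of_nonneg_right h2 (by positivity)) (by positivity)
      _ = |A| * ℓ * (1 + (ξ / ℓ) ^ 2)⁻¹ := by field_simp
  have hUOm : Tendsto (fun ξ => U ξ * Om ξ) atTop (𝓝 0) := by
    refine squeeze_zero_norm (a := fun ξ => |A| * ℓ / 4 * (|A| / 2 * (1 + (ξ / ℓ) ^ 2)⁻¹)) (fun ξ => ?_)
      (by simpa using (hlim.const_mul (|A| / 2)).const_mul (|A| * ℓ / 4))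
    simp only [hUdef, hOmdef]
    rw [norm_mul, Real.norm_eq_abs, Real.norm_eq_abs]
    have hUb : |-A * ℓ * primProfile (ξ / ℓ)| ≤ |A| * ℓ / 4 := by
      rw [abs_mul, abs_mul, abs_neg, abs_of_pos hℓ]
      have := abs_primProfile_le (ξ / ℓ)
      calc |A| * ℓ * |primProfile (ξ / ℓ)| ≤ |A| * ℓ * (1 / 4) := mul_le_mul_of_nonneg_left this (by positivity)
        _ = |A| * ℓ / 4 := by ring
    have hOb : |-A * profile (ξ / ℓ)| ≤ |A| / 2 * (1 + (ξ / ℓ) ^ 2)⁻¹ := by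
      rw [abs_mul, abs_neg]
      have := abs_profile_le (ξ / ℓ)
      calc |A| * |profile (ξ / ℓ)| ≤ |A| * (1 / (2 * (1 + (ξ / ℓ) ^ 2))) := mul_le_mul_of_nonneg_left this (abs_nonneg _)
        _ = |A| / 2 * (1 + (ξ / ℓ) ^ 2)⁻¹ := by field_simp
    exact mul_le_mul hUb hOb (abs_nonneg _) (by positivity)
  have hdOmInf : Tendsto dOm atTop (𝓝 0) := by
    refine squeeze_zero_norm (a := fun ξ => |A| / ℓ * (3 * (1 + (ξ / ℓ) ^ 2)⁻¹)) (fun ξ => ?_)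
      (by simpa using (hlim.const_mul 3).const_mul (|A| / ℓ))
    simp only [hdOmdef]
    rw [Real.norm_eq_abs, abs_mul, abs_neg, abs_div, abs_of_pos hℓ]
    exact mul_le_mul_of_nonneg_left (abs_dProfile_le (ξ / ℓ)) (by positivity)
  -- instantiate (★)
  have h := halfLine_identity_gCLM 1 (1 / 3) a ε (hilbertTransform Om) U Om dOm ddOm hU hOm hdOm hOm0 hF iOm iHOm iξd iUd
    idd hξOm hUOm hdOmInf
  simpa [hOmdef, hdOmdef] using h

end SheetHalfLine
end Summit.NavierStokesRegularity.OSWSelfSimilar
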